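import Literature.AnabelianGeometry.EtaleTheta.FrobenioidMonoThetaThm510iSub
import Literature.AnabelianGeometry.EtaleTheta.Discharge.Sec5Thm510i
import Mathlib.Tactic.Group
import HarnessLib

/-!
# [EtTh] Theorem 5.10 (i) / Lemma 5.8 (arithmetic step) — sub-DAG proofs (L2 §K row K5)

Mochizuki, *The étale theta function and its Frobenioid-theoretic manifestations*, Publ. RIMS **45**
(2009) [cite: MochizukiEtTh2009, Lem 5.8 p.331 (PDF p.105)], [cite: MochizukiEtTh2009, Thm 5.10 (i) p.333 (PDF p.107)].
Layer L2 of the abc-iut cell, sub-DAG `plan/L2/SUBDAG-EtTh-Thm510i.md` (holder abc-iut-w4-d095).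
PROOF-ONLY companion (no definitions) of `FrobenioidMonoThetaThm510iSub.lean`, over abc-iut-L2-t4's
`FrobenioidMonoTheta.lean` and abc-iut-L2-d4's `Discharge/Sec5Thm510i.lean`:

* **L58-A2 (Kummer criterion, PROVED)** `actsByCyclotome_iff_pow_invariant`: for a unit `u ∈ O^×(B_N)`,
  "`Π^tp_Y` acts on `u` via multiplication by an element of `μ_N(B_N)`" (abc-iut-L2-t4's `ActsByCyclotome u`)
  iff `u^N` is fixed by `Π^tp_Y` — pure group theory (`O^×(B_N)` abelian and normal in `Aut_C(B_N)`,
  `μ_N(B_N)` = its `N`-torsion);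
* **L58-A4 (reduction, PROVED)** `constantsActByCyclotome_of_invariantUnitsEqConstants`: abc-iut-L2-t4's
  named arithmetic step `ConstantsActByCyclotome` ("this last set is easily seen to coincide with
  `(O_K^×)^{1/N}`") FOLLOWS from the single arithmetic input `InvariantUnitsEqConstants`
  ("`(O^×(B_N))^{Π^tp_Y} = O_K^×`", "`Y` geometrically connected over `K`"); hence Lemma 5.8's main assertion
  `ConstantsEqNormalizer` modulo {`SgpCapSection`, `InvariantUnitsEqConstants`}
  (`constantsEqNormalizer_of_invariantUnitsEqConstants`, via abc-iut-L2-t4's `constantsEqNormalizer_of`);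
* **L58-B1 consequences (PROVED)**: a Kummer extension `act` of the constants' action (`IsKummerExtension`)
  forces `(O_K^×)^{1/N}` to normalise `E_N` (`IsKummerExtension.okxRootN_le_normalizer`) and lets
  `μ_N(B_N)` act by INNER automorphisms (`IsKummerExtension.act_muTorsion_eq_conj`), so that it induces an
  outer action of `(K^×)^{1/N}/μ_N(B_N)`; conversely the conjugation action of any unit acting by the
  cyclotome is a Kummer shift (`conj_mul_inv_mem_muTorsion_of_actsByCyclotome`, consistency of clause (a)
  with clause (b));
* **T510i (node, BY NAME)** `preservesIsoClasses_of_rows`: abc-iut-L2-d4's discharge of Theorem 5.10 (i)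
  (`preservesIsoClasses_of`, p408065) with the sub-DAG's row names T510i-L01…L08.

HONEST FRAMING: kernel-checked implications between typed statements about the §5 data; [EtTh] is
refereed; typed ≠ proved for the genuine data; nothing here bears on [IUTchIII] Cor. 3.12 or takes a side.
-/

namespace Literature.AnabelianGeometry.EtaleTheta

open CategoryTheory

universe w v v' u u'

namespace ThetaFrobenioid

variable {C : Type u} [Category.{v} C] {D : Type u'} [Category.{v'} D] (𝔉 : ThetaFrobenioid.{w} C D)

/-! ### L58-A2: the Kummer criterion -/

/-- **L58-A2 (Kummer criterion).** For a unit `u ∈ O^×(B_N)`: `Π^tp_Y̲` (through `s^⊓-gp_N`) "acts on `u`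
via multiplication by an element of `μ_N(B_N)`" iff it FIXES `u^N`.  (`O^×(B_N)` is abelian and normal in
`Aut_C(B_N)`; `μ_N(B_N)` is its `N`-torsion: for `c = s^⊓-gp_N(y)` the commutator `w = c u c⁻¹ u⁻¹` is a unit
with `w^N = (c u^N c⁻¹) · u^{-N}`.)  This is the group-theoretic half of "this last set is easily seen to
coincide with `(O_K^×)^{1/N}`" (proof of Lemma 5.8, p.331 (PDF p.105) ll.22–24).
[cite: MochizukiEtTh2009, Lem 5.8 proof p.331 (PDF p.105)] -/
theorem actsByCyclotome_iff_pow_invariant {u : Aut 𝔉.BN} (hu : u ∈ 𝔉.units 𝔉.BN) :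
    𝔉.ActsByCyclotome u ↔
      ∀ y ∈ 𝔉.imPiY, 𝔉.sgpCap y * u ^ (𝔉.N : ℕ) * (𝔉.sgpCap y)⁻¹ = u ^ (𝔉.N : ℕ) := by
  haveI := 𝔉.units_normal 𝔉.BN
  have key : ∀ c : Aut 𝔉.BN,
      (c * u * c⁻¹ * u⁻¹ ∈ 𝔉.muTorsion 𝔉.BN 𝔉.N ↔ c * u ^ (𝔉.N : ℕ) * c⁻¹ = u ^ (𝔉.N : ℕ)) := by
    intro c
    have hcu : c * u * c⁻¹ ∈ 𝔉.units 𝔉.BN := (𝔉.units_normal 𝔉.BN).conj_mem u hu c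
    have hw : c * u * c⁻¹ * u⁻¹ ∈ 𝔉.units 𝔉.BN :=
      (𝔉.units 𝔉.BN).mul_mem hcu ((𝔉.units 𝔉.BN).inv_mem hu)
    have hcomm : Commute (c * u * c⁻¹) u⁻¹ :=
      setLike_mul_comm (s := 𝔉.units 𝔉.BN) hcu ((𝔉.units 𝔉.BN).inv_mem hu)
    have hpow : (c * u * c⁻¹ * u⁻¹) ^ (𝔉.N : ℕ) = c * u ^ (𝔉.N : ℕ) * c⁻¹ * (u ^ (𝔉.N : ℕ))⁻¹ := by
      rw [hcomm.mul_pow, conj_pow, inv_pow]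
    rw [mem_muTorsion, hpow, mul_inv_eq_one]
    exact ⟨fun h => h.2, fun h => ⟨hw, h⟩⟩
  constructor
  · intro h y hy
    exact (key (𝔉.sgpCap y)).mp (h y hy)
  · intro h y hy
    exact (key (𝔉.sgpCap y)).mpr (h y hy)

/-- The `N`-th power of a unit, as an element of `O^×(B_N)`, maps to the `N`-th power in `O^×(B_N^birat)`.
[cite: MochizukiEtTh2009, Lem 5.8 p.331 (PDF p.105)] -/
theorem unitsToBirat_pow (u : 𝔉.units 𝔉.BN) (n : ℕ) :
    𝔉.unitsToBirat 𝔉.BN (u ^ n) = 𝔉.unitsToBirat 𝔉.BN u ^ n := map_pow _ u n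

/-! ### L58-A4: the named arithmetic step of Lemma 5.8 from `(O^×(B_N))^{Π^tp_Y} = O_K^×` -/

/-- **L58-A4.** abc-iut-L2-t4's named arithmetic step of Lemma 5.8 (`ConstantsActByCyclotome`: `(O_K^×)^{1/N}`
= the units on which `Π^tp_Y` acts through `μ_N(B_N)`) FOLLOWS from "`(O^×(B_N))^{Π^tp_Y} = O_K^×`"
(`InvariantUnitsEqConstants`) by the Kummer criterion: `u ∈ (O_K^×)^{1/N}` iff `u^N` is a constant iff `u^N` is
`Π^tp_Y`-fixed iff `Π^tp_Y` acts on `u` through `μ_N(B_N)`.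
[cite: MochizukiEtTh2009, Lem 5.8 proof p.331 (PDF p.105)] -/
theorem constantsActByCyclotome_of_invariantUnitsEqConstants (h : 𝔉.InvariantUnitsEqConstants) :
    𝔉.ConstantsActByCyclotome := by
  intro u
  constructor
  · rintro ⟨v, hv, rfl⟩
    change (v : Aut 𝔉.BN) ∈ 𝔉.units 𝔉.BN ∧ 𝔉.ActsByCyclotome (v : Aut 𝔉.BN)
    refine ⟨v.2, ?_⟩
    rw [𝔉.actsByCyclotome_iff_pow_invariant v.2]
    have hvN : 𝔉.unitsToBirat 𝔉.BN (v ^ (𝔉.N : ℕ)) ∈ 𝔉.constEmb.range := by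
      rw [unitsToBirat_pow]
      exact (𝔉.mem_KxRootN).mp hv
    have hfix := (h (v ^ (𝔉.N : ℕ))).mpr hvN
    intro y hy
    simpa [Subgroup.coe_pow] using hfix y hy
  · rintro ⟨hu, hact⟩
    refine ⟨⟨u, hu⟩, ?_, rfl⟩
    change 𝔉.unitsToBirat 𝔉.BN ⟨u, hu⟩ ∈ 𝔉.KxRootN
    rw [𝔉.mem_KxRootN, ← unitsToBirat_pow]
    apply (h (⟨u, hu⟩ ^ (𝔉.N : ℕ))).mp
    intro y hy
    simpa [Subgroup.coe_pow] using (𝔉.actsByCyclotome_iff_pow_invariant hu).mp hact y hy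

/-- **Lemma 5.8 (main assertion) modulo its two printed inputs**: `(O_K^×)^{1/N}` = the elements of
`O^×(B_N)` normalising `E_N`, from the section property of `s^⊓-gp_N` (abc-iut-L2-t4's group-theoretic step
`mem_normalizer_EN_iff`) and "`(O^×(B_N))^{Π^tp_Y} = O_K^×`" (this sub-DAG's `InvariantUnitsEqConstants`).
[cite: MochizukiEtTh2009, Lem 5.8 p.331 (PDF p.105)] -/
theorem constantsEqNormalizer_of_invariantUnitsEqConstants (hsec : 𝔉.SgpCapSection)
    (h : 𝔉.InvariantUnitsEqConstants) : 𝔉.ConstantsEqNormalizer :=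
  𝔉.constantsEqNormalizer_of hsec (𝔉.constantsActByCyclotome_of_invariantUnitsEqConstants h)

/-! ### L58-B1: consequences of a Kummer extension; consistency of its two clauses -/

/-- `μ_N(B_N) ⊆ E_N`. [cite: MochizukiEtTh2009, Lem 5.9 (iv) p.332 (PDF p.106)] -/
theorem muTorsion_le_EN : 𝔉.muTorsion 𝔉.BN 𝔉.N ≤ 𝔉.EN :=
  le_sectionSubgroup 𝔉.sgpCap 𝔉.imPiY (𝔉.muTorsion 𝔉.BN 𝔉.N)

/-- A unit acting by the cyclotome gives a KUMMER SHIFT on `E_N`: for `u ∈ O^×(B_N)` with `ActsByCyclotome u`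
and `e ∈ E_N`, `u e u⁻¹ · e⁻¹ ∈ μ_N(B_N)` (write `e = s^⊓-gp_N(y) · ζ`; units commute).  Consistency of clause
(a) of `IsKummerExtension` with clause (b).  [cite: MochizukiEtTh2009, Lem 5.8 proof p.331 (PDF p.105)] -/
theorem conj_mul_inv_mem_muTorsion_of_actsByCyclotome {u : Aut 𝔉.BN} (hu : u ∈ 𝔉.units 𝔉.BN)
    (hact : 𝔉.ActsByCyclotome u) {e : Aut 𝔉.BN} (he : e ∈ 𝔉.EN) :
    u * e * u⁻¹ * e⁻¹ ∈ 𝔉.muTorsion 𝔉.BN 𝔉.N := by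
  haveI := 𝔉.muTorsion_normal 𝔉.BN 𝔉.N
  obtain ⟨y, hy, ζ, hζ, rfl⟩ := (mem_sectionSubgroup_iff 𝔉.sgpCap 𝔉.imPiY (𝔉.muTorsion 𝔉.BN 𝔉.N)).mp he
  have hζu : ζ * u⁻¹ = u⁻¹ * ζ :=
    setLike_mul_comm (s := 𝔉.units 𝔉.BN) (𝔉.muTorsion_le_units 𝔉.BN 𝔉.N hζ)
      ((𝔉.units 𝔉.BN).inv_mem hu)
  have hinv := (𝔉.muTorsion 𝔉.BN 𝔉.N).inv_mem (hact y hy)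
  have hrw : u * (𝔉.sgpCap y * ζ) * u⁻¹ * (𝔉.sgpCap y * ζ)⁻¹ =
      (𝔉.sgpCap y * u * (𝔉.sgpCap y)⁻¹ * u⁻¹)⁻¹ := by
    calc u * (𝔉.sgpCap y * ζ) * u⁻¹ * (𝔉.sgpCap y * ζ)⁻¹
        = u * 𝔉.sgpCap y * (ζ * u⁻¹) * ζ⁻¹ * (𝔉.sgpCap y)⁻¹ := by group
      _ = u * 𝔉.sgpCap y * (u⁻¹ * ζ) * ζ⁻¹ * (𝔉.sgpCap y)⁻¹ := by rw [hζu]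
      _ = (𝔉.sgpCap y * u * (𝔉.sgpCap y)⁻¹ * u⁻¹)⁻¹ := by group
  rw [hrw]
  exact hinv

namespace IsKummerExtension

variable {𝔉} {act : 𝔉.KxRootN →* MulAut 𝔉.EN} (hK : 𝔉.IsKummerExtension act)
include hK

/-- Under a Kummer extension, `(O_K^×)^{1/N}` normalises `E_N` (the first "In particular" of Lemma 5.8:
"a natural outer action of `(O_K^×)^{1/N}/μ_N(B_N)` on `E_N`").
[cite: MochizukiEtTh2009, Lem 5.8 p.331 (PDF p.105)] -/
theorem okxRootN_le_normalizer :
    𝔉.OKxRootN ≤ Subgroup.normalizer (𝔉.EN : Set (Aut 𝔉.BN)) := by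
  rintro _ ⟨v, hv, rfl⟩
  change (v : Aut 𝔉.BN) ∈ Subgroup.normalizer (𝔉.EN : Set (Aut 𝔉.BN))
  rw [Subgroup.mem_normalizer_iff]
  intro e
  constructor
  · intro he
    have h := hK.2 v hv ⟨e, he⟩
    change ((act ⟨𝔉.unitsToBirat 𝔉.BN v, hv⟩ ⟨e, he⟩ : 𝔉.EN) : Aut 𝔉.BN) = (v : Aut 𝔉.BN) * e * (v : Aut 𝔉.BN)⁻¹
      at h
    rw [← h]
    exact (act ⟨𝔉.unitsToBirat 𝔉.BN v, hv⟩ ⟨e, he⟩).2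
  · intro he
    have hv' : 𝔉.unitsToBirat 𝔉.BN v⁻¹ ∈ 𝔉.KxRootN := by
      rw [map_inv]
      exact 𝔉.KxRootN.inv_mem hv
    have h := hK.2 v⁻¹ hv' ⟨_, he⟩
    have hmem := (act ⟨𝔉.unitsToBirat 𝔉.BN v⁻¹, hv'⟩ ⟨_, he⟩).2
    rw [h] at hmem
    simpa [mul_assoc] using hmem

/-- Under a Kummer extension, every `ζ ∈ μ_N(B_N)` (`⊆ (O_K^×)^{1/N}`) acts on `E_N` by the INNER automorphism
`conj ζ` (`ζ ∈ E_N`) — so the action descends to an outer action of `(K^×)^{1/N}/μ_N(B_N)` (Lemma 5.8: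
"outer action of `(K^×)^{1/N}/μ_N(B_N) (⥲ K^×)`").  [cite: MochizukiEtTh2009, Lem 5.8 p.331 (PDF p.105)] -/
theorem act_muTorsion_eq_conj {ζ : Aut 𝔉.BN} (hζ : ζ ∈ 𝔉.muTorsion 𝔉.BN 𝔉.N) :
    ∃ (hmem : 𝔉.unitsToBirat 𝔉.BN ⟨ζ, 𝔉.muTorsion_le_units 𝔉.BN 𝔉.N hζ⟩ ∈ 𝔉.KxRootN),
      ∀ e : 𝔉.EN, act ⟨_, hmem⟩ e = MulAut.conj (⟨ζ, 𝔉.muTorsion_le_EN hζ⟩ : 𝔉.EN) e := by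
  have hζN : (⟨ζ, 𝔉.muTorsion_le_units 𝔉.BN 𝔉.N hζ⟩ : 𝔉.units 𝔉.BN) ^ (𝔉.N : ℕ) = 1 := by
    apply Subtype.ext
    simpa [Subgroup.coe_pow] using (𝔉.mem_muTorsion.mp hζ).2
  have hmem : 𝔉.unitsToBirat 𝔉.BN ⟨ζ, 𝔉.muTorsion_le_units 𝔉.BN 𝔉.N hζ⟩ ∈ 𝔉.KxRootN := by
    rw [𝔉.mem_KxRootN, ← unitsToBirat_pow, hζN, map_one]
    exact 𝔉.constEmb.range.one_mem
  refine ⟨hmem, fun e => ?_⟩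
  apply Subtype.ext
  rw [hK.2 _ hmem e]
  rfl

end IsKummerExtension

/-- **From the `K^×`-extension to the first half of Lemma 5.8**: if the constants' action extends
(`KxOuterActionExtends`), then `(O_K^×)^{1/N}` normalises `E_N`.
[cite: MochizukiEtTh2009, Lem 5.8 p.331 (PDF p.105)] -/
theorem okxRootN_le_normalizer_of_kxOuterActionExtends (h : 𝔉.KxOuterActionExtends) :
    𝔉.OKxRootN ≤ Subgroup.normalizer (𝔉.EN : Set (Aut 𝔉.BN)) := by
  obtain ⟨act, hK⟩ := h
  exact hK.okxRootN_le_normalizer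

/-! ### T510i: the node, by the sub-DAG's row names -/

/-- **[EtTh] Theorem 5.10 (i) from its sub-DAG rows** (T510i-L01 `A_N` Frobenius-trivial · L02
`PsiPreservesFrobeniusTrivial` · L03 `PsiBaseIsoAN` · L04 [FrdI] Thm 5.1 (iii) · L06 "`Ψ` preserves pre-steps"
· L07 [FrdI] Def 1.3 (iii)(d) · L08 `DivSCapTransported`) — abc-iut-L2-d4's `preservesIsoClasses_of`
(`Discharge/Sec5Thm510i.lean`, p408065) with the row names of `FrobenioidMonoThetaThm510iSub.lean`.
[cite: MochizukiEtTh2009, Thm 5.10 (i) p.333–334 (PDF pp.107–108)] -/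
theorem preservesIsoClasses_of_rows (Ψ : C ≌ C)
    (hL01 : 𝔉.IsFrobeniusTrivial 𝔉.AN)
    (hL02 : 𝔉.PsiPreservesFrobeniusTrivial Ψ.functor)
    (hL03 : 𝔉.PsiBaseIsoAN Ψ.functor)
    (hL04 : ∀ S T : C, 𝔉.IsFrobeniusTrivial S → 𝔉.IsFrobeniusTrivial T → 𝔉.pre.BaseIsomorphic S T →
      Nonempty (S ≅ T))
    (hL06 : Literature.AlgebraicGeometry.Frobenioids.PreFrobenioidData.PreservesMor Ψ.functor
      𝔉.IsPreStep 𝔉.IsPreStep)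
    (hL07 : ∀ {A B B' : C} (φ : A ⟶ B) (φ' : A ⟶ B'), 𝔉.IsPreStep φ → 𝔉.IsPreStep φ' →
      𝔉.pre.div φ = 𝔉.pre.div φ' → Nonempty (B ≅ B'))
    (hL08 : 𝔉.DivSCapTransported Ψ) :
    𝔉.PreservesIsoClasses Ψ :=
  preservesIsoClasses_of Ψ hL01 hL02 hL03 hL04 hL06 hL07 hL08

end ThetaFrobenioid

end Literature.AnabelianGeometry.EtaleTheta
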